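import Mathlib.LinearAlgebra.Matrix.Determinant.Basic
import Mathlib.Data.Fintype.Card
import Mathlib.Logic.Equiv.Fin.Basic
import Mathlib.Data.Int.Order.Units
import Mathlib.Algebra.Algebra.Basic
import Mathlib.LinearAlgebra.Span.Defs
import HarnessLib

/-!
# Maximal minors of a unit-row-stacked family `[I ; X]` = all minors of `X` (Laplace along unit rows)
# (crux `FInjectiveMacaulayfication` stmt-ResolutionOfSingularities-15315, chain w45a; second half of piece (S) of res-L1-w45a-lead-1 g8's TIER-2 FILE PLAN 06:27:54Z
# for LEMMA N♭ — «𝔑₀ = I_r([I_r ; X]) = Σ_k I_k(X)»; seat res-L1-w45a-stub-1 g9)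

[OURS · L1 W4.5a] Support file (`--supports stmt-ResolutionOfSingularities-15315 --as helper`); pure matrix algebra over a commutative ring `S` with spans over a
subring of scalars `R → S`; def-free, unconditional. AI-written (AI review is weaker than expert review). Companion of `…FrobeniusNormMinors.lean` (norm module =
span of maximal minors of the root-coordinate matrix of the generators): there the generators of `A` over `A^q` are the basis monomials (unit rows) and their
multiples by `√z` (rows of a matrix `X`), so the generator matrix is `[I ; X]` up to reindexing.

* `det_eq_sign_mul_det_of_unit_rows` — ★ LAPLACE ALONG A SET OF UNIT ROWS: if, after reindexing rows and columns by `ι ≃ p ⊕ q`, the `p`-rows of `M` are the unit vectors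
  at the `p`-columns, then `det M = sign · det (q × q block)` (`Matrix.det_fromBlocks_zero₁₂` + `det_permute'`).
* `det_unitRowStack_mem_span_minors` — every maximal minor of `[I ; X]` (rows `Sum.elim (fun i => Pi.single i 1) (fun x j => X x j) ∘ σ`, any `σ : ι → ι ⊕ m`) lies in the `R`-span of
  the minors `(X.submatrix r c).det`, `r : Fin k → m`, `c : Fin k → ι`, all `k`;
* `det_submatrix_mem_span_unitRowStack` — conversely every minor of `X` IS a maximal minor of `[I ; X]` (complete the chosen columns by unit rows; no sign);
* ★★ `span_maximalMinors_unitRowStack_eq` — the two `R`-spans coincide; `span_minors_eq_span_injMinors` — only injective `r`, `c` matter;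
  `span_range_det_rows_comp_equiv` — reindexing the generator family; `det_submatrix_smul` — minors of `a • X` are `a^k ·` minors of `X`.

[folklore (Laplace expansion / maximal minors of `[I ; X]`)]
-/

namespace Summit.ResolutionOfSingularities.ResolutionOfSingularities.Theorems.FInjectiveMacaulayfication.UnitRowMinors

set_option linter.dupNamespace false

open Matrix

variable {S : Type*} [CommRing S] {R : Type*} [CommRing R] [Algebra R S]
variable {ι : Type*} [Fintype ι] [DecidableEq ι]

/-! ## §1 Laplace along a set of unit rows -/

omit [Algebra R S] in
/-- ★ **Laplace along a set of unit rows.** If the rows `er⁻¹(inl a)` of `M` are the unit vectors at the columns `ec⁻¹(inl a)` (`a : p`), then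
`det M = sign(ec⁻¹ ≫ er) · det (M restricted to the rows er⁻¹(inr ·) and columns ec⁻¹(inr ·))`. [folklore] -/
theorem det_eq_sign_mul_det_of_unit_rows {p q : Type*} [Fintype p] [Fintype q] [DecidableEq p] [DecidableEq q]
    (M : Matrix ι ι S) (er ec : ι ≃ p ⊕ q) (hunit : ∀ a : p, M (er.symm (Sum.inl a)) = Pi.single (ec.symm (Sum.inl a)) 1) :
    M.det = ((Equiv.Perm.sign (ec.symm.trans er) : ℤ) : S) * (Matrix.of fun b b' : q => M (er.symm (Sum.inr b)) (ec.symm (Sum.inr b'))).det := by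
  set τ : Equiv.Perm (p ⊕ q) := ec.symm.trans er with hτ
  set D : Matrix q q S := Matrix.of fun b b' : q => M (er.symm (Sum.inr b)) (ec.symm (Sum.inr b')) with hD
  have h1 : M.submatrix er.symm ec.symm = (M.submatrix er.symm er.symm).submatrix id τ := by
    ext x y
    simp only [submatrix_apply, id_eq, hτ, Equiv.trans_apply, Equiv.symm_apply_apply]
  have h2 : (M.submatrix er.symm ec.symm).det = ((Equiv.Perm.sign τ : ℤ) : S) * M.det := by
    rw [h1, det_permute', det_submatrix_equiv_self]
  have h3 : M.submatrix er.symm ec.symm =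
      Matrix.fromBlocks 1 0 (Matrix.of fun b a => M (er.symm (Sum.inr b)) (ec.symm (Sum.inl a))) D := by
    ext x y
    rcases x with a | b <;> rcases y with a' | b'
    · simp only [submatrix_apply, fromBlocks_apply₁₁, hunit, Pi.single_apply, EmbeddingLike.apply_eq_iff_eq, Sum.inl.injEq, one_apply]
      exact if_congr eq_comm rfl rfl
    · simp [submatrix_apply, hunit]
    · simp [submatrix_apply, hD]
    · simp [submatrix_apply, hD]
  have h4 : (M.submatrix er.symm ec.symm).det = D.det := by
    rw [h3, det_fromBlocks_zero₁₂, det_one, one_mul]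
  have hs : ((Equiv.Perm.sign τ : ℤ) : S) * ((Equiv.Perm.sign τ : ℤ) : S) = 1 := by
    rw [← Int.cast_mul, ← Units.val_mul, Int.units_mul_self, Units.val_one, Int.cast_one]
  calc M.det = ((Equiv.Perm.sign τ : ℤ) : S) * (((Equiv.Perm.sign τ : ℤ) : S) * M.det) := by rw [← mul_assoc, hs, one_mul]
    _ = ((Equiv.Perm.sign τ : ℤ) : S) * D.det := by rw [← h2, h4]

omit [Algebra R S] in
/-- Same with ONE decomposition for rows and columns (unit rows on the diagonal): no sign. -/
theorem det_eq_det_of_unit_rows_diag {p q : Type*} [Fintype p] [Fintype q] [DecidableEq p] [DecidableEq q]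
    (M : Matrix ι ι S) (e : ι ≃ p ⊕ q) (hunit : ∀ a : p, M (e.symm (Sum.inl a)) = Pi.single (e.symm (Sum.inl a)) 1) :
    M.det = (Matrix.of fun b b' : q => M (e.symm (Sum.inr b)) (e.symm (Sum.inr b'))).det := by
  rw [det_eq_sign_mul_det_of_unit_rows M e e hunit, Equiv.symm_trans_self, Equiv.Perm.sign_refl, Units.val_one, Int.cast_one, one_mul]

/-! ## §2 Maximal minors of `[I ; X]` versus minors of `X` -/

variable {m : Type*}

omit [Algebra R S] in
/-- A square matrix with a repeated row selection has determinant `0`. -/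
theorem det_rows_eq_zero_of_not_injective {N : Type*} (G : N → ι → S) {σ : ι → N} (hσ : ¬ Function.Injective σ) :
    (Matrix.of fun i => G (σ i)).det = 0 := by
  obtain ⟨i, j, hij, hne⟩ := Function.not_injective_iff.mp hσ
  exact det_zero_of_row_eq hne (by ext l; simp [hij])

/-- ★ **Every maximal minor of `[I ; X]` is (±) a minor of `X`**, hence lies in the `R`-span of the minors of `X` of all sizes. [folklore] -/
theorem det_unitRowStack_mem_span_minors [Fintype m] (X : Matrix m ι S) (σ : ι → ι ⊕ m) :
    (Matrix.of fun i => Sum.elim (fun i : ι => (Pi.single i 1 : ι → S)) (fun x j => X x j) (σ i)).det ∈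
      Submodule.span R {d : S | ∃ (k : ℕ) (r : Fin k → m) (c : Fin k → ι), d = (X.submatrix r c).det} := by
  classical
  set M : Matrix ι ι S := Matrix.of fun i => Sum.elim (fun i : ι => (Pi.single i 1 : ι → S)) (fun x j => X x j) (σ i) with hM
  by_cases hσ : Function.Injective σ
  swap
  · rw [det_rows_eq_zero_of_not_injective _ hσ]
    exact Submodule.zero_mem _
  -- unit slots `p` and `X`-slots `q`
  let P : ι → Prop := fun i => ∃ a, σ i = Sum.inl a
  let p := {i // P i}
  let q := {i // ¬ P i}
  let er : ι ≃ p ⊕ q := (Equiv.sumCompl P).symm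
  have her_inl : ∀ a : p, er.symm (Sum.inl a) = a.1 := fun a => rfl
  have her_inr : ∀ b : q, er.symm (Sum.inr b) = b.1 := fun b => rfl
  -- the unit columns `j a` (`σ a = inl (j a)`), injective
  let j : p → ι := fun a => Classical.choose a.2
  have hj : ∀ a : p, σ a.1 = Sum.inl (j a) := fun a => Classical.choose_spec a.2
  have hjinj : Function.Injective j := by
    intro a a' h
    apply Subtype.ext
    apply hσ
    rw [hj, hj, h]
  -- the `X`-rows `xr b` (`σ b = inr (xr b)`)
  have hx : ∀ b : q, ∃ x, σ b.1 = Sum.inr x := by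
    intro b
    rcases h : σ b.1 with a | x
    · exact absurd ⟨a, h⟩ b.2
    · exact ⟨x, rfl⟩
  choose xr hxr using hx
  -- column decomposition `ec : ι ≃ p ⊕ q` with `ec⁻¹(inl a) = j a`
  have hcard : Fintype.card {i // i ∉ Set.range j} = Fintype.card q := by
    have h1 : Fintype.card {i // i ∉ Set.range j} = Fintype.card ι - Fintype.card {i // i ∈ Set.range j} :=
      Fintype.card_subtype_compl _
    have h2 : Fintype.card {i // i ∈ Set.range j} = Fintype.card p := by
      rw [← Set.card_range_of_injective hjinj]
    have h3 : Fintype.card ι = Fintype.card p + Fintype.card q := by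
      rw [← Fintype.card_sum]
      exact Fintype.card_congr er
    omega
  let e₁ : p ≃ {i // i ∈ Set.range j} := Equiv.ofInjective j hjinj
  let e₂ : {i // i ∉ Set.range j} ≃ q := Fintype.equivOfCardEq hcard
  let ec : ι ≃ p ⊕ q := (Equiv.sumCompl fun i => i ∈ Set.range j).symm.trans (Equiv.sumCongr e₁.symm e₂)
  have hec_inl : ∀ a : p, ec.symm (Sum.inl a) = j a := fun a => rfl
  -- unit rows
  have hunit : ∀ a : p, M (er.symm (Sum.inl a)) = Pi.single (ec.symm (Sum.inl a)) 1 := by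
    intro a
    rw [her_inl, hec_inl, hM]
    change Sum.elim (fun i : ι => (Pi.single i 1 : ι → S)) (fun x j => X x j) (σ a.1) = _
    rw [hj a, Sum.elim_inl]
  have hdet := det_eq_sign_mul_det_of_unit_rows M er ec hunit
  -- the `q × q` block is a minor of `X`
  let cc : q → ι := fun b' => ec.symm (Sum.inr b')
  have hblock : (Matrix.of fun b b' : q => M (er.symm (Sum.inr b)) (ec.symm (Sum.inr b'))) = X.submatrix xr cc := by
    ext b b'
    simp only [Matrix.of_apply, submatrix_apply, her_inr, hM, hxr b, Sum.elim_inr, cc]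
  let eq : q ≃ Fin (Fintype.card q) := Fintype.equivFin q
  have hfin : (X.submatrix xr cc).det = (X.submatrix (xr ∘ eq.symm) (cc ∘ eq.symm)).det := by
    rw [← det_submatrix_equiv_self eq.symm (X.submatrix xr cc)]
    rfl
  rw [hdet, hblock, hfin]
  -- `± minor ∈ span`
  have hmem : (X.submatrix (xr ∘ eq.symm) (cc ∘ eq.symm)).det ∈
      Submodule.span R {d : S | ∃ (k : ℕ) (r : Fin k → m) (c : Fin k → ι), d = (X.submatrix r c).det} :=
    Submodule.subset_span ⟨Fintype.card q, xr ∘ eq.symm, cc ∘ eq.symm, rfl⟩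
  rcases Int.units_eq_one_or (Equiv.Perm.sign (ec.symm.trans er)) with h | h
  · rw [h, Units.val_one, Int.cast_one, one_mul]
    exact hmem
  · rw [h, Units.val_neg, Units.val_one, Int.cast_neg, Int.cast_one, neg_one_mul]
    exact Submodule.neg_mem _ hmem

omit [Fintype ι] [DecidableEq ι] [Algebra R S] in
/-- A minor with a repeated column or row selection vanishes. -/
theorem det_submatrix_eq_zero_of_not_injective (X : Matrix m ι S) {k : ℕ} (r : Fin k → m) (c : Fin k → ι)
    (h : ¬ Function.Injective r ∨ ¬ Function.Injective c) : (X.submatrix r c).det = 0 := by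
  rcases h with h | h
  · obtain ⟨s, s', hss, hne⟩ := Function.not_injective_iff.mp h
    exact det_zero_of_row_eq hne (by ext l; simp [hss])
  · obtain ⟨s, s', hss, hne⟩ := Function.not_injective_iff.mp h
    exact det_zero_of_column_eq hne fun l => by simp [hss]

/-- ★ **Every minor of `X` is a maximal minor of `[I ; X]`** (complete the chosen columns `c` by the unit rows of the other columns; equal sign). [folklore] -/
theorem det_submatrix_mem_span_unitRowStack (X : Matrix m ι S) {k : ℕ} (r : Fin k → m) (c : Fin k → ι) :
    (X.submatrix r c).det ∈ Submodule.span R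
      (Set.range fun σ : ι → ι ⊕ m => (Matrix.of fun i => Sum.elim (fun i : ι => (Pi.single i 1 : ι → S)) (fun x j => X x j) (σ i)).det) := by
  classical
  by_cases hc : Function.Injective c
  swap
  · rw [det_submatrix_eq_zero_of_not_injective X r c (Or.inr hc)]
    exact Submodule.zero_mem _
  -- slots: columns outside `range c` carry their own unit row, the column `c s` carries the row `X (r s)`
  let ecq : Fin k ≃ {i // i ∈ Set.range c} := Equiv.ofInjective c hc
  let σ : ι → ι ⊕ m := fun i => if h : i ∈ Set.range c then Sum.inr (r (ecq.symm ⟨i, h⟩)) else Sum.inl i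
  have hσc : ∀ s, σ (c s) = Sum.inr (r s) := by
    intro s
    simp only [σ, dif_pos (Set.mem_range_self s)]
    congr 2
    exact Equiv.ofInjective_symm_apply hc s
  have hσu : ∀ i, i ∉ Set.range c → σ i = Sum.inl i := fun i hi => by simp only [σ, dif_neg hi]
  set M : Matrix ι ι S := Matrix.of fun i => Sum.elim (fun i : ι => (Pi.single i 1 : ι → S)) (fun x j => X x j) (σ i) with hM
  -- one decomposition for rows and columns
  let e : ι ≃ {i // i ∉ Set.range c} ⊕ Fin k :=
    (Equiv.sumCompl fun i => i ∈ Set.range c).symm.trans ((Equiv.sumComm _ _).trans (Equiv.sumCongr (Equiv.refl _) ecq.symm))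
  have he_inl : ∀ b : {i // i ∉ Set.range c}, e.symm (Sum.inl b) = b.1 := fun b => rfl
  have he_inr : ∀ s : Fin k, e.symm (Sum.inr s) = c s := fun s => rfl
  have hunit : ∀ b : {i // i ∉ Set.range c}, M (e.symm (Sum.inl b)) = Pi.single (e.symm (Sum.inl b)) 1 := by
    intro b
    rw [he_inl, hM]
    change Sum.elim (fun i : ι => (Pi.single i 1 : ι → S)) (fun x j => X x j) (σ b.1) = _
    rw [hσu b.1 b.2, Sum.elim_inl]
  have hdet := det_eq_det_of_unit_rows_diag M e hunit
  have hblock : (Matrix.of fun s s' : Fin k => M (e.symm (Sum.inr s)) (e.symm (Sum.inr s'))) = X.submatrix r c := by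
    ext s s'
    simp only [Matrix.of_apply, submatrix_apply, he_inr, hM, hσc s, Sum.elim_inr]
  rw [← hblock, ← hdet]
  exact Submodule.subset_span ⟨σ, rfl⟩

/-- ★★ **Maximal minors of `[I ; X]` and minors of `X` span the same `R`-submodule**: `I_r([I_r ; X]) = Σ_k I_k(X)`. [folklore] -/
theorem span_maximalMinors_unitRowStack_eq [Fintype m] (X : Matrix m ι S) :
    Submodule.span R (Set.range fun σ : ι → ι ⊕ m => (Matrix.of fun i => Sum.elim (fun i : ι => (Pi.single i 1 : ι → S)) (fun x j => X x j) (σ i)).det) =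
      Submodule.span R {d : S | ∃ (k : ℕ) (r : Fin k → m) (c : Fin k → ι), d = (X.submatrix r c).det} := by
  refine le_antisymm (Submodule.span_le.mpr ?_) (Submodule.span_le.mpr ?_)
  · rintro d ⟨σ, rfl⟩
    exact det_unitRowStack_mem_span_minors X σ
  · rintro d ⟨k, r, c, rfl⟩
    exact det_submatrix_mem_span_unitRowStack X r c

omit [Fintype ι] [DecidableEq ι] in
/-- Only injective row and column selections matter (`I_k(X)` in the usual sense). -/
theorem span_minors_eq_span_injMinors (X : Matrix m ι S) :
    Submodule.span R {d : S | ∃ (k : ℕ) (r : Fin k → m) (c : Fin k → ι), d = (X.submatrix r c).det} =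
      Submodule.span R {d : S | ∃ (k : ℕ) (r : Fin k → m) (c : Fin k → ι),
        Function.Injective r ∧ Function.Injective c ∧ d = (X.submatrix r c).det} := by
  refine le_antisymm (Submodule.span_le.mpr ?_) (Submodule.span_mono ?_)
  · rintro d ⟨k, r, c, rfl⟩
    by_cases h : Function.Injective r ∧ Function.Injective c
    · exact Submodule.subset_span ⟨k, r, c, h.1, h.2, rfl⟩
    · rw [SetLike.mem_coe, det_submatrix_eq_zero_of_not_injective X r c (not_and_or.mp h)]
      exact Submodule.zero_mem _
  · rintro d ⟨k, r, c, -, -, rfl⟩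
    exact ⟨k, r, c, rfl⟩

omit [DecidableEq ι] [Fintype ι] in
/-- Reindexing the generator family does not change the span of the row-selection determinants. -/
theorem span_range_det_rows_comp_equiv [Fintype ι] [DecidableEq ι] {N N' : Type*} (G : N → ι → S) (eN : N' ≃ N) :
    Submodule.span R (Set.range fun σ : ι → N => (Matrix.of fun i => G (σ i)).det) =
      Submodule.span R (Set.range fun σ' : ι → N' => (Matrix.of fun i => G (eN (σ' i))).det) := by
  congr 1
  ext d
  constructor
  · rintro ⟨σ, rfl⟩
    exact ⟨fun i => eN.symm (σ i), by simp⟩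
  · rintro ⟨σ', rfl⟩
    exact ⟨fun i => eN (σ' i), rfl⟩

omit [Fintype ι] [DecidableEq ι] [Algebra R S] in
/-- Minors of a rescaled matrix: `det ((a • X).submatrix r c) = a ^ k * det (X.submatrix r c)`. -/
theorem det_submatrix_smul (X : Matrix m ι S) (a : S) {k : ℕ} (r : Fin k → m) (c : Fin k → ι) :
    ((a • X).submatrix r c).det = a ^ k * (X.submatrix r c).det := by
  have h : (a • X).submatrix r c = a • X.submatrix r c := rfl
  rw [h, det_smul, Fintype.card_fin]

end Summit.ResolutionOfSingularities.ResolutionOfSingularities.Theorems.FInjectiveMacaulayfication.UnitRowMinors
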